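import Mathlib
import HarnessLib
import Summits.Ventures.LatticeQCDFlow.Scoring.PooledESS

/-!
# LatticeQCDFlow / Scoring — the pooled Kish ESS is a HARMONIC combination of the per-sector
# ones: `1/ESS_pooled = Σ_g π̂_g² / ESS_g` exactly, hence
# `m·N_sec ≤ ESS_pooled ≤ min_g ESS_g/π̂_g²` and `ESS_pooled ≤ M·N_sec`

HONEST FRAMING: exact (Metropolis-corrected) sampling algorithms for lattice gauge theory;
figures of merit are autocorrelation/cost numbers at stated couplings and volumes; no
continuum-physics claim.

Venture `LatticeQCDFlow` (cell pub-lqcd), sub-topic `Scoring`; FANOUT row 3 (`s0-u1-a`, S0-B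
implementation A — deliverable 'per-sector ESS' — GEN-7).  NEW WORK of the cell (elementary finite
sums), not a published result; NO definition is introduced.  Sharpens row 11's `Scoring/PooledESS`
(`min_g ESS_g ≤ ESS_pooled ≤ Σ_g ESS_g`) from two inequalities to one identity.

## Content

In reweight mode a scored record set is a finite family of positive importance weights `wᵢ` on the
pooled samples `i ∈ s`, each labelled by its topological sector `grp i`; FITNESS §1 / FITNESS-A §A3
report the pooled Kish count `ESS_pooled = kishESS s w = (Σ_s w)²/Σ_s w²` AND the per-sector counts
`ESS_g = kishESS s_g w` on the fibres `s_g = {i ∈ s | grp i = g}`.  Write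
`π̂_g = (Σ_{s_g} w)/(Σ_s w)` for the REWEIGHTED sector fraction (the record set's own importance
estimate of the target sector weight; `Σ_g π̂_g = 1`) and `N_sec = 1/Σ_g π̂_g²` for the effective
number of populated sectors (`1 ≤ N_sec ≤ #sectors`).

* `inv_kishESS_eq_sum_fibers` — **the identity**: for positive weights
  `1/ESS_pooled = Σ_{g present} π̂_g² / ESS_g` (no hypothesis beyond positivity; both sides are `0`
  on the empty family).  The pooled figure is therefore a FUNCTION of the per-sector table and the
  reweighted sector fractions — it carries no further information — and it is the `π̂²`-weighted
  HARMONIC combination, so it is hostage to every sector in proportion to the square of its mass: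
* `kishESS_le_fiber_div_sq_frac` — **one thin sector caps the pool**: for every sector `g` present,
  `ESS_pooled ≤ ESS_g / π̂_g²` (a sector carrying reweighted mass `π̂_g = 0.2` with `ESS_g = 3`
  effective samples caps the pooled count at `75`, whatever `N` and the other sectors are);
* `div_sum_sq_frac_le_kishESS` / `mul_le_kishESS_of_forall_le_fibers` — **the floor gains the
  effective number of sectors**: if every sector present has `ESS_g ≥ m > 0` then
  `ESS_pooled ≥ m / Σ_g π̂_g² = m·N_sec` (row 11's floor is the case `N_sec ≥ 1`,
  `sum_sq_frac_le_one`);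
* `kishESS_le_div_sum_sq_frac` — and the matching ceiling `ESS_pooled ≤ M·N_sec` when every
  `ESS_g ≤ M`: between them, `ESS_pooled / N_sec` is a genuine (weighted harmonic) MEAN of the
  per-sector counts.

Population twin (NOT restated here): for laws `p`, `q` on a product of a sector label and a fine
variable, `1/ESS(p, q) = Σ_c (p_C(c)²/q_C(c))·1/ESS(p(·|c), q(·|c))` is item 119a of HOME/THEORY-2.md
§4 (T2-AJ, `inv_essFrac_kerLaw_eq`, HOME tier at the time of writing); the finite identity below is
what the two PRINTED numbers of a record set obey, sample by sample, with `π̂_g` in place of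
`p_C²/q_C`-weights.

NOT CLAIMED: any ESS, sector fraction or sector count of ours; anything about chain-mode per-sector
ESS (`N_g/(2τ_int(1[Q = g]))`, see `Scoring/SectorMinESSCeiling`); nothing re-scored.
-/

namespace Summit.Ventures.LatticeQCDFlow.Scoring

open Finset

variable {ι κ : Type*}

/-! ### Aggregate form -/

/-- With group aggregates `A_g ≠ 0` (first moments) and `B_g` (second moments), the per-group
Kish value `K_g = A_g²/B_g` returns the second moment: `Σ_g A_g²/K_g = Σ_g B_g`. [folklore] -/
theorem sum_sq_div_kish_eq (G : Finset κ) (A B : κ → ℝ) (hA : ∀ g ∈ G, A g ≠ 0) :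
    ∑ g ∈ G, A g ^ 2 / (A g ^ 2 / B g) = ∑ g ∈ G, B g :=
  sum_congr rfl fun g hg => div_div_cancel₀ (pow_ne_zero 2 (hA g hg))

/-- **Harmonic pooling, aggregate form.**  With `A = Σ_g A_g ≠ 0`, every `A_g ≠ 0` and
`K_g = A_g²/B_g`: `(A²/Σ_g B_g)⁻¹ = Σ_g (A_g/A)²/K_g`. [folklore] -/
theorem inv_pooled_eq_sum_groups (G : Finset κ) (A B : κ → ℝ) (hA : ∀ g ∈ G, A g ≠ 0)
    (hS : ∑ g ∈ G, A g ≠ 0) :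
    ((∑ g ∈ G, A g) ^ 2 / ∑ g ∈ G, B g)⁻¹
      = ∑ g ∈ G, ((A g / ∑ h ∈ G, A h) ^ 2) / (A g ^ 2 / B g) := by
  rw [inv_div, ← sum_sq_div_kish_eq G A B hA, sum_div]
  refine sum_congr rfl fun g _ => ?_
  rw [div_pow]
  have hS2 : (∑ h ∈ G, A h) ^ 2 ≠ 0 := pow_ne_zero 2 hS
  field_simp

/-! ### The identity on a labelled family of positive weights -/

section Fibers

variable [DecidableEq κ]

/-- A label present has a non-empty fibre with positive first moment. -/
theorem sum_fiber_pos (s : Finset ι) (w : ι → ℝ) (grp : ι → κ) (hw : ∀ i ∈ s, 0 < w i)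
    {g : κ} (hg : g ∈ s.image grp) : 0 < ∑ i ∈ s.filter (fun i => grp i = g), w i := by
  obtain ⟨i, hi, rfl⟩ := mem_image.mp hg
  exact sum_pos (fun j hj => hw j (mem_filter.mp hj).1) ⟨i, mem_filter.mpr ⟨hi, rfl⟩⟩

/-- A label present has a fibre with positive Kish ESS. -/
theorem kishESS_fiber_pos (s : Finset ι) (w : ι → ℝ) (grp : ι → κ) (hw : ∀ i ∈ s, 0 < w i)
    {g : κ} (hg : g ∈ s.image grp) : 0 < kishESS (s.filter (fun i => grp i = g)) w := by
  obtain ⟨i, hi, rfl⟩ := mem_image.mp hg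
  exact div_pos (pow_pos (sum_fiber_pos s w grp hw hg) 2)
    (sum_sq_pos_of_pos ⟨i, mem_filter.mpr ⟨hi, rfl⟩⟩ (fun j hj => hw j (mem_filter.mp hj).1))

/-- **The pooled Kish ESS is the `π̂²`-weighted harmonic combination of the per-sector Kish ESS.**
For positive weights `w` on a finite family `s` labelled by `grp` (sectors, streams), with fibres
`s_g = {i ∈ s | grp i = g}` and reweighted label fractions `π̂_g = (Σ_{s_g} w)/(Σ_s w)`:
`1 / kishESS s w = Σ_{g ∈ grp '' s} π̂_g² / kishESS s_g w` — EXACTLY (both sides vanish on the empty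
family).  Sedrakyan's inequality of `PooledESS.kishESS_le_sum_fibers` and the floor
`le_kishESS_of_forall_le_fibers` are its two one-line corollaries; the sharper ones follow. -/
theorem inv_kishESS_eq_sum_fibers (s : Finset ι) (w : ι → ℝ) (grp : ι → κ)
    (hw : ∀ i ∈ s, 0 < w i) :
    (kishESS s w)⁻¹ = ∑ g ∈ s.image grp,
      ((∑ i ∈ s.filter (fun i => grp i = g), w i) / ∑ i ∈ s, w i) ^ 2
        / kishESS (s.filter (fun i => grp i = g)) w := by
  rcases s.eq_empty_or_nonempty with rfl | hs
  · simp [kishESS]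
  have hmaps : ∀ i ∈ s, grp i ∈ s.image grp := fun i hi => mem_image_of_mem grp hi
  have hA : ∑ i ∈ s, w i = ∑ g ∈ s.image grp, ∑ i ∈ s.filter (fun i => grp i = g), w i :=
    (sum_fiberwise_of_maps_to hmaps _).symm
  have hB : ∑ i ∈ s, w i ^ 2
      = ∑ g ∈ s.image grp, ∑ i ∈ s.filter (fun i => grp i = g), w i ^ 2 :=
    (sum_fiberwise_of_maps_to hmaps _).symm
  have hAg : ∀ g ∈ s.image grp, ∑ i ∈ s.filter (fun i => grp i = g), w i ≠ 0 :=
    fun g hg => (sum_fiber_pos s w grp hw hg).ne'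
  have hSne : ∑ i ∈ s, w i ≠ 0 := (sum_pos hw hs).ne'
  unfold kishESS
  rw [hA, hB] at *
  rw [hA] at hSne
  exact inv_pooled_eq_sum_groups _ _ _ hAg hSne

/-! ### Corollaries: one thin sector caps the pool; the floor and ceiling gain `N_sec` -/

/-- **One sector caps the pooled ESS.**  For every label `g` present:
`kishESS s w ≤ kishESS s_g w / π̂_g²` — a sector holding reweighted mass fraction `π̂_g` with `ESS_g`
effective samples caps the pooled Kish count at `ESS_g/π̂_g²`, whatever the total sample count and
the other sectors. -/
theorem kishESS_le_fiber_div_sq_frac (s : Finset ι) (w : ι → ℝ) (grp : ι → κ)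
    (hw : ∀ i ∈ s, 0 < w i) {g : κ} (hg : g ∈ s.image grp) :
    kishESS s w ≤ kishESS (s.filter (fun i => grp i = g)) w
      / ((∑ i ∈ s.filter (fun i => grp i = g), w i) / ∑ i ∈ s, w i) ^ 2 := by
  obtain ⟨i₀, hi₀, _⟩ := mem_image.mp hg
  have hs : s.Nonempty := ⟨i₀, hi₀⟩
  have hK : 0 < kishESS s w :=
    div_pos (pow_pos (sum_pos hw hs) 2) (sum_sq_pos_of_pos hs hw)
  have hfrac : 0 < (∑ i ∈ s.filter (fun i => grp i = g), w i) / ∑ i ∈ s, w i :=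
    div_pos (sum_fiber_pos s w grp hw hg) (sum_pos hw hs)
  have hKg : 0 < kishESS (s.filter (fun i => grp i = g)) w := kishESS_fiber_pos s w grp hw hg
  have hterm : 0 < ((∑ i ∈ s.filter (fun i => grp i = g), w i) / ∑ i ∈ s, w i) ^ 2
      / kishESS (s.filter (fun i => grp i = g)) w := div_pos (pow_pos hfrac 2) hKg
  -- the `g`-term of the identity is at most the whole sum
  have hle : ((∑ i ∈ s.filter (fun i => grp i = g), w i) / ∑ i ∈ s, w i) ^ 2
      / kishESS (s.filter (fun i => grp i = g)) w ≤ (kishESS s w)⁻¹ := by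
    rw [inv_kishESS_eq_sum_fibers s w grp hw]
    refine single_le_sum (f := fun h => ((∑ i ∈ s.filter (fun i => grp i = h), w i)
        / ∑ i ∈ s, w i) ^ 2 / kishESS (s.filter (fun i => grp i = h)) w) ?_ hg
    intro h hh
    exact div_nonneg (sq_nonneg _) (kishESS_nonneg _ _)
  have := (le_inv_comm₀ hterm hK).mp hle
  rwa [inv_div] at this

/-- The reweighted label fractions are a probability vector: `Σ_g π̂_g = 1` on a non-empty family
of positive weights. -/
theorem sum_frac_fibers_eq_one (s : Finset ι) (w : ι → ℝ) (grp : ι → κ)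
    (hw : ∀ i ∈ s, 0 < w i) (hs : s.Nonempty) :
    ∑ g ∈ s.image grp, (∑ i ∈ s.filter (fun i => grp i = g), w i) / ∑ i ∈ s, w i = 1 := by
  have hmaps : ∀ i ∈ s, grp i ∈ s.image grp := fun i hi => mem_image_of_mem grp hi
  rw [← sum_div, sum_fiberwise_of_maps_to hmaps, div_self (sum_pos hw hs).ne']

/-- `Σ_g π̂_g² ≤ 1`, i.e. the effective number of populated sectors `N_sec = 1/Σ_g π̂_g²` is at least
one. -/
theorem sum_sq_frac_fibers_le_one (s : Finset ι) (w : ι → ℝ) (grp : ι → κ)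
    (hw : ∀ i ∈ s, 0 < w i) (hs : s.Nonempty) :
    ∑ g ∈ s.image grp, ((∑ i ∈ s.filter (fun i => grp i = g), w i) / ∑ i ∈ s, w i) ^ 2 ≤ 1 := by
  have h1 := sum_frac_fibers_eq_one s w grp hw hs
  have hnn : ∀ g ∈ s.image grp,
      0 ≤ (∑ i ∈ s.filter (fun i => grp i = g), w i) / ∑ i ∈ s, w i :=
    fun g hg => (div_pos (sum_fiber_pos s w grp hw hg) (sum_pos hw hs)).le
  calc ∑ g ∈ s.image grp, ((∑ i ∈ s.filter (fun i => grp i = g), w i) / ∑ i ∈ s, w i) ^ 2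
      ≤ (∑ g ∈ s.image grp, (∑ i ∈ s.filter (fun i => grp i = g), w i) / ∑ i ∈ s, w i) ^ 2 :=
        sum_sq_le_sq_sum_of_nonneg _ _ hnn
    _ = 1 := by rw [h1, one_pow]

/-- `0 < Σ_g π̂_g²` on a non-empty family of positive weights. -/
theorem sum_sq_frac_fibers_pos (s : Finset ι) (w : ι → ℝ) (grp : ι → κ)
    (hw : ∀ i ∈ s, 0 < w i) (hs : s.Nonempty) :
    0 < ∑ g ∈ s.image grp, ((∑ i ∈ s.filter (fun i => grp i = g), w i) / ∑ i ∈ s, w i) ^ 2 :=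
  sum_pos (fun _ hg => pow_pos (div_pos (sum_fiber_pos s w grp hw hg) (sum_pos hw hs)) 2)
    (hs.image grp)

/-- **The floor gains the effective number of sectors.**  If every label present has
`m ≤ kishESS s_g w` with `m > 0`, then `m / Σ_g π̂_g² ≤ kishESS s w`, i.e.
`ESS_pooled ≥ m·N_sec`: five equally weighted sectors each holding `m` effective samples pool to at
least `5m` (row 11's `le_kishESS_of_forall_le_fibers` gives `m`). -/
theorem div_sum_sq_frac_le_kishESS (s : Finset ι) (w : ι → ℝ) (grp : ι → κ)
    (hw : ∀ i ∈ s, 0 < w i) (hs : s.Nonempty) {m : ℝ} (hm0 : 0 < m)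
    (hm : ∀ g ∈ s.image grp, m ≤ kishESS (s.filter (fun i => grp i = g)) w) :
    m / ∑ g ∈ s.image grp, ((∑ i ∈ s.filter (fun i => grp i = g), w i) / ∑ i ∈ s, w i) ^ 2
      ≤ kishESS s w := by
  set S := ∑ g ∈ s.image grp,
    ((∑ i ∈ s.filter (fun i => grp i = g), w i) / ∑ i ∈ s, w i) ^ 2 with hSdef
  have hSpos : 0 < S := sum_sq_frac_fibers_pos s w grp hw hs
  have hK : 0 < kishESS s w :=
    div_pos (pow_pos (sum_pos hw hs) 2) (sum_sq_pos_of_pos hs hw)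
  -- `1/K = Σ π̂² / K_g ≤ Σ π̂² / m = S / m`
  have hinv : (kishESS s w)⁻¹ ≤ S / m := by
    rw [inv_kishESS_eq_sum_fibers s w grp hw, hSdef, sum_div]
    refine sum_le_sum fun g hg => ?_
    exact div_le_div_of_nonneg_left (sq_nonneg _) hm0 (hm g hg)
  have hSm : 0 < S / m := div_pos hSpos hm0
  have h := (inv_le_comm₀ hK hSm).mp hinv
  rwa [inv_div] at h

/-- The same floor in product form: `m · N_sec ≤ ESS_pooled` with `N_sec = (Σ_g π̂_g²)⁻¹`. -/
theorem mul_le_kishESS_of_forall_le_fibers (s : Finset ι) (w : ι → ℝ) (grp : ι → κ)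
    (hw : ∀ i ∈ s, 0 < w i) (hs : s.Nonempty) {m : ℝ} (hm0 : 0 < m)
    (hm : ∀ g ∈ s.image grp, m ≤ kishESS (s.filter (fun i => grp i = g)) w) :
    m * (∑ g ∈ s.image grp,
      ((∑ i ∈ s.filter (fun i => grp i = g), w i) / ∑ i ∈ s, w i) ^ 2)⁻¹ ≤ kishESS s w := by
  rw [← div_eq_mul_inv]
  exact div_sum_sq_frac_le_kishESS s w grp hw hs hm0 hm

/-- **The matching ceiling**: if every label present has `kishESS s_g w ≤ M`, then
`kishESS s w ≤ M / Σ_g π̂_g² = M·N_sec`.  With the floor: `ESS_pooled/N_sec` lies between the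
smallest and the largest per-sector Kish count — it is a (π̂²-weighted harmonic) mean of them. -/
theorem kishESS_le_div_sum_sq_frac (s : Finset ι) (w : ι → ℝ) (grp : ι → κ)
    (hw : ∀ i ∈ s, 0 < w i) (hs : s.Nonempty) {M : ℝ}
    (hM : ∀ g ∈ s.image grp, kishESS (s.filter (fun i => grp i = g)) w ≤ M) :
    kishESS s w ≤ M / ∑ g ∈ s.image grp,
      ((∑ i ∈ s.filter (fun i => grp i = g), w i) / ∑ i ∈ s, w i) ^ 2 := by
  set S := ∑ g ∈ s.image grp,
    ((∑ i ∈ s.filter (fun i => grp i = g), w i) / ∑ i ∈ s, w i) ^ 2 with hSdef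
  have hSpos : 0 < S := sum_sq_frac_fibers_pos s w grp hw hs
  have hK : 0 < kishESS s w :=
    div_pos (pow_pos (sum_pos hw hs) 2) (sum_sq_pos_of_pos hs hw)
  obtain ⟨g₀, hg₀⟩ := hs.image grp
  have hM0 : 0 < M := (kishESS_fiber_pos s w grp hw hg₀).trans_le (hM g₀ hg₀)
  -- `1/K = Σ π̂² / K_g ≥ Σ π̂² / M = S / M`
  have hinv : S / M ≤ (kishESS s w)⁻¹ := by
    rw [inv_kishESS_eq_sum_fibers s w grp hw, hSdef, sum_div]
    refine sum_le_sum fun g hg => ?_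
    exact div_le_div_of_nonneg_left (sq_nonneg _) (kishESS_fiber_pos s w grp hw hg) (hM g hg)
  have hSM : 0 < S / M := div_pos hSpos hM0
  have h := (le_inv_comm₀ hSM hK).mp hinv
  rwa [inv_div] at h

end Fibers

end Summit.Ventures.LatticeQCDFlow.Scoring
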